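import Summits.BirchSwinnertonDyer.BirchSwinnertonDyer.Theses.CyclotomicUntwist
import Summits.BirchSwinnertonDyer.BirchSwinnertonDyer.Theorems.CyclotomicUntwistFiniteSlopeSeparatedPinnedLogNormOneSidedSigmaLine
import Summits.BirchSwinnertonDyer.BirchSwinnertonDyer.Theorems.CyclotomicUntwistLineCoefficients
import Summits.BirchSwinnertonDyer.BirchSwinnertonDyer.Theorems.CyclotomicUntwistPSUntwistedTraceDefs
import Summits.BirchSwinnertonDyer.BirchSwinnertonDyer.Theorems.CyclotomicUntwistDescendedFrobeniusEigenconstantCoeffs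
import Literature.NumberTheory.EllipticCurves.DescendedFrobeniusMatrix
import Summits.BirchSwinnertonDyer.BirchSwinnertonDyer.Theorems.CyclotomicUntwistPSRankOneLowerHalfAtThreeDescendedFrobenius
import Summits.BirchSwinnertonDyer.BirchSwinnertonDyer.Theorems.CyclotomicUntwistNineRankTwoReduction
import Summits.BirchSwinnertonDyer.BirchSwinnertonDyer.Theorems.CyclotomicUntwistPSRankOneLowerHalfAtThreeKatzRankLeTwoSupersingular
import Summits.BirchSwinnertonDyer.BirchSwinnertonDyer.Theorems.CyclotomicUntwistC1OfPrintFive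
import HarnessLib

/-! Line `dfrob-kato` (v9, lead bsd-line-cycu-p1 g9, 2026-08-28T18:1xZ: print stub S1p `stub_PRINT_C1` SHRUNK from five to FOUR named print facts — the Carayol-LEVEL conjunct `IsNewformOf.level_eq_conductorNorm` is DROPPED: it is a tree theorem granted modularity (`PSC1OfPrintFive.level_eq_conductorNorm_of_modularity` = `IsNewformOf.level_eq_conductorNorm_of_exists_isNewformOf'` ∘ `exists_isNewformOf_of_nonempty_modularParametrizationData`, cycu-p3 g11 p653768); `stub_EX` (C1) is now fed by `PSC1OfPrintFive.psUntwistedLFunctionAtThree_of_print5`; candidate prepared and checked by cycu-p3 g11 (evidence dfrob_{wan,kato}_v9_candidate.lean), registered by the lead. OPEN registered stubs (4): S1p `stub_PRINT_C1` (print: modularity, GZ86 I.(7.3), Deligne/Hida 3.26, Carayol (A)), S4 `stub_NGZ3_dfrob` (C4 27546, research), S5 (C5 one-sided: 27614 | 27592, research), S6 `stub_PUB` (GZK, print). By-name conditional closers of record: `PSRankOneHalvesOfCruxesFive.psRankOne{Lower,Upper}HalfAtThree_of_cruxes_of_print5` (p3 g11). BSD is not proved by any of this); (v8, lead bsd-line-cycu-p1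 g8, 2026-08-28T17:3xZ: stub S1w `stub_WILD` CLOSED TWICE — by name and UNCONDITIONALLY by cycu-p5 g15's `InertiaWildAtThreeUnconditional.stub_WILD_unconditional` (p652834, the registered v7 text with no hypotheses: ¬TypeG + Néron–Ogg–Shafarevich + restriction), and modulo print by cycu-p3 g10's `InertiaWildAtThree.hwild_two_eq_four_of_classO6_of_print` / `stub_WILD_of_print` (p650778/p651051/p651957), the latter consumed inside the by-name capstone `PSC1OfPrint.psUntwistedLFunctionAtThree_of_print` (p651954: C1 ⟸ six named print facts) used below; OPEN registered stubs (4): S1p `stub_PRINT_C1` (print), S4 `stub_NGZ3_dfrob` (C4, research), S5 (C5 one-sided, research), S6 `stub_PUB` (GZK, print)); (v7, lead bsd-line-cycu-p1 g8, 2026-08-28T17:1xZ: stub S1 `stub_EX` = crux child C1 `PSUntwistedLFunctionAtThree` is NO LONGER A STUB — it is a THEOREM of this file over three finer registered stubs through the landed capstone `PSC1OfPrint.psUntwistedLFunctionAtThree_of_print_of_wild` (p650696 = cycu-p4 g12's C1-glue p649627 ∘ the lead's UNIFORM ROOT LAW `UniformRootLaw.uniformRootLaw_of_print` p650112, itself over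 `CoinvariantEigenvalue` p646654, `InertiaOverCyclotomicNine` p647742, `NineCharacter` p648344, `UntwistFrame` p649180, `UntwistDatum` p649527 and the engine `map_reverse_charpoly_toInertiaCoinvariants_twist_eq`): S1p `stub_PRINT_C1` = FIVE NAMED PRINT FACTS by name (modularity `nonempty_modularParametrizationData`, Carayol level `IsNewformOf.level_eq_conductorNorm`, `GrossZagier1986_thm_I_7_3`, Deligne `Hida2000_thm326_exists_galoisRep`, `Carayol1986_eulerFactor`), S1w `stub_WILD` = GALOIS WILDNESS of `V₂(W)` at `3` on the PS rows (cycu-p3 g10's `InertiaWildAtThree` discharges it modulo the same print, ETA 20:30Z ⇒ v8), S6 `stub_PUB` (GZK). OPEN registered stubs (5): S1p (print), S1w (print-reducible), S4 `stub_NGZ3_dfrob` (C4 27546, research), S5 (C5 one-sided, research), S6 (print). The RESEARCH wall of the line is now exactly {C4, C5}; memo `Cruxes/PSUntwistedLFunctionAtThree/LAW-T-KERNEL-v1.md`);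
 (v6, lead bsd-line-cycu-p1 g8, 2026-08-28: stub S5≤ `stub_pBSD3le_dfrob` RESHAPED — one extra hypothesis `Finite W.sha →` after
`W.analyticRank = 1 →`, discharged INSIDE the composition by S6 `stub_PUB` (GZK gives `Finite W.sha` at `r_an ≤ 1`). WHY: with `W.shaOrder = Nat.card Ш`
(junk `0` when `Ш(E)` is infinite) the v5 text asserted, in the corner «`Ш(E)` infinite, `P` non-torsion», that `c₁(𝓛)·ϖ·log₃γ = 0` — so ANY proof of the
v5 stub (= item C5≤ 27592 verbatim) had to prove finiteness of the WHOLE `Ш(E)` on the PS rows, a Kolyvagin-strength input foreign to the «Kato direction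
only» child; the reshaped stub is implied by the filed item (item ⟹ stub by weakening) and is exactly what a Kato-side divisibility + descent delivers
(`ord₃ #Ш = ord₃ #Ш[3^∞]` once `Ш` is finite, `padicValNat_card_addPrimaryComponent`). K2's closure is unchanged (same closer, same other stubs); S4, S5≥ (K1
side) have no such corner (an infinite `Ш` makes S5≥ trivially true and does not enter S4). Pen: re-filing 27592 with the `Finite W.sha` binder is recommended,
not required (the filed text is stronger). Previous history follows. v5, lead bsd-line-cycu-p1 g6: the one-sided K2 variant of `dfrob` — S5 = N-pBSD₃′^{≤} ONLY = route item C5≤ stmt-BirchSwinnertonDyer-27592 `PSpAdicBSDKatoSideDescendedEigenlineAtThree` (K2's K-SEP family, rev 6; glue item 27594 `PSUpperHalfOfDFrobKatoChildren`);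
v5 = stub S2k `stub_KATZ_rankLeTwo_supersingular` CLOSED BY IMPORT: landed VERBATIM (same namespace, same name, registered signature) by cycu-p4 g8 as
`Theorems/CyclotomicUntwistPSRankOneLowerHalfAtThreeKatzRankLeTwoSupersingular.lean` (p640759) — Katz 1981 Thm 5.3.3 (rank ≤ 2) on supersingular fibres is a KERNEL THEOREM
(elementary route: W1 cycu-p3 SecondKindLog · Λ cycu-p4 p636923 · digits cycu-p3/cycu-p2 g7 p640419 · B1 cycu-p1 p638957 · bridge cycu-p4 p639390 · W4 cycu-p4 p637939/p638179 · p639930;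
independent second proof cycu-p3 p640457); hence S2a `isDescendedFrobeniusMatrix_exists` is an UNCONDITIONAL THEOREM of this file. OPEN registered stubs (4): S1 `stub_EX` (C1 27548, research),
S4 `stub_NGZ3_dfrob` (C4 27546, research), S5 (C5 one-sided, research), S6 `stub_PUB` (PublishedInputGZK, print);
v4 = stubs S2e `stub_ETA_secondKind` and S2p `stub_ETA_offOmegaLine` CLOSED BY IMPORT (cycu-p5 g10: `NineRankTwoReduction.secondKind_classEta`,
`not_hbd_classEta_sub_C_mul_classOmega` over the UNCONDITIONAL `classesIndependent_of_three_dvd_specialFibreTrace`, p637357/p637942) — they are THEOREMS of this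
file now; S2a := `NineRankTwoReduction.isDescendedFrobeniusMatrix_exists_of_katzRank_supersingular stub_KATZ_rankLeTwo_supersingular`; OPEN registered stubs (5):
S1 `stub_EX`, S2k `stub_KATZ_rankLeTwo_supersingular` (elementary route in flight: W1 p3, ★ digits p2 g7, Λ ✓ p4, assembly/bridge p1 p638957 + p4, H3ss → S2k ✓ p4 p638179), S4, S5, S6;
v3 = the PRINT stub S2a `stub_PRINT_descendedFrobenius_exists` (the Literature named fact `isDescendedFrobeniusMatrix_exists`) is NO LONGER A STUB:
it is DERIVED (sorry-free, `descendedFrobenius_exists_of_stubs`) from three finer registered stubs through the landed capstone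
`NineNamedFactOfKatzRank.isDescendedFrobeniusMatrix_exists_of_katzRankLeTwo_supersingular` (p637057/p637456): S2k `stub_KATZ_rankLeTwo_supersingular`
(Katz 1981 Thm 5.3.3 on supersingular fibres — print `Literature…katz_dieudonne_rank_le_two` p636408 or the elementary route W1–W4),
S2e `stub_ETA_secondKind`, S2p `stub_ETA_offOmegaLine` (cycu-p5 g10 W5 / File D); open stubs: S1, S2k, S2e, S2p, S4, S5, S6 (7);
v2 = S2 `stub_descendedFrobenius` CLOSED BY IMPORT (landed verbatim by cycu-p3 g7, p629220, same namespace and name) and the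
stub ↔ item dictionary recorded: S1 `stub_EX` = C1 stmt-27548, S4 `stub_NGZ3_dfrob` = C4 stmt-27546, S2a/S6 = the two PRINT
inputs of C2 stmt-27549; closer `…NormOneSidedSigmaLine…_le`; v1 by cycu-p1 g5 on the stubs of `dfrob` v3) for the crux K2 `PSRankOneUpperHalfAtThree` (stmt-BirchSwinnertonDyer-21581) of route `CyclotomicUntwist` — THE K-SEP LINE THAT CONSUMES
`WeierstrassCurve.IsDescendedFrobeniusMatrix` AT THE K1 DATUM (pen ruling bsd-wall-pss3x g4/g5, K-SEP addendum 2026-08-28T09:22Z / 10:21Z, gate (a)).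

Composition = the closer of record `CyclotomicUntwistFiniteSlopeSeparatedPinnedLogNorm.
psRankOne_halves_of_separated_pin_intrinsic_sigmaLine_log_norm` (p619715: K1 ∧ K2 ⟸ PUB + EX′(a_w, ϖ) +
N-GZ₃′ + pBSD₃′ with D5 = σ-line height, numbers `(c₀, a, b)`) over the COEFFICIENT PACKAGE of
`CyclotomicUntwistLineCoefficients` (`K = ℚ₃(ζ₃)`, the line `ψ` with `ψ(2) = ζ₃`, its conjugation `σ`, an
embedding `ι : K ↪ ℂ₃`), with the D5 numbers NO LONGER FREE: `c₀ := 0` and `(a, b)` = the coordinates in the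
basis `(1, ζ₃)` of the EIGENLINE CONSTANT `c(α) = (M₀₀ + α − tr M)/M₁₀` of THE descended Frobenius matrix `M`
(`IsDescendedFrobeniusMatrix W M`, unique by `IsDescendedFrobeniusMatrix.unique`; dictionary
`CyclotomicUntwistDescendedFrobeniusEigenline`, audit GZ3-CONSTANT-AUDIT-v1-ADDENDUM-1 §3) at the admissible
root `α` of EX′. Stubs (7 registered; S2 and S3 LANDED ⇒ 5 open: S1, S2a, S4, S5, S6 — three research stubs + two print inputs):
* `stub_EX` — EX′ with `aw := psUntwistedTrace` (text of record; D1 existence + rationality; RESEARCH);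
* `descendedFrobenius_exists_of_stubs` — the Literature named fact `isDescendedFrobeniusMatrix_exists` BY NAME
  (print input); `stub_descendedFrobenius` — GIVEN that fact, on the principal-series rows: `∃ M,
  IsDescendedFrobeniusMatrix W M ∧ tr M = psUntwistedTrace W ∧ M₁₀ ≠ 0` (kernel modulo print, size M: a
  `NineGoodModel` over `𝓞_{ℚ₃(ζ₉)}` from the GNineCriterion recipes + a reduction map + cycu-p3's LAW (N);
  reduction `CyclotomicUntwistDescendedFrobeniusOfGoodModel.stub_descendedFrobenius_of`);
* `stub_eigenconstant_coeffs` — KERNEL (size S): for `det M = 3`, `tr M ∈ {0, ±3}`, `M₁₀ ≠ 0` and a root `α`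
  of `X² − (tr M)X + 3` in `ℂ₃`: `∃ a b : ℚ₃, b ≠ 0 ∧ (a + b·ι(ψ 2))·M₁₀ = M₀₀ + (α − tr M)` (`α ∈ ℚ₃(ζ₃)`);
* `stub_NGZ3_dfrob`, `stub_pBSD3_dfrob` — the texts of record N-GZ₃′ / pBSD₃′ re-quantified `∀ M,
  IsDescendedFrobeniusMatrix W M → ∀ a b, b ≠ 0 → dictionary(M, α, a, b) → ∀ Dh, σ-line spec(0, a, b) → …`
  (RESEARCH cruxes: the 3-adic Gross–Zagier formula at slope 1/2 for `(E, η)` read on the `ψ`-eigenline height,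
  and the `3`-adic BSD leading-term identity; nothing `∃`-quantified over numbers — guard p618360 respected);
* `stub_PUB` — `PublishedInputGZK` (item 19921 by name).
The composition is sorry-free; BSD is not proved by this file and no stub is. -/

set_option linter.dupNamespace false
set_option autoImplicit false
noncomputable section
open scoped Classical MatrixGroups
open CongruenceSubgroup WeierstrassCurve WeierstrassCurve.Affine.Point Literature.NumberTheory.EllipticCurves
  Literature.NumberTheory.EllipticCurves.ModularForms Literature.NumberTheory.EllipticCurves.Rank1Residual
  Literature.NumberTheory.IwasawaTheory Summit.BirchSwinnertonDyer.Rank1Residual.Additive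
  Summit.BirchSwinnertonDyer.BirchSwinnertonDyer.Theses.CyclotomicUntwist
  Summit.BirchSwinnertonDyer.BirchSwinnertonDyer.Theorems.CyclotomicUntwistFiniteSlopeSeparatedPinnedLogNorm
  Summit.BirchSwinnertonDyer.BirchSwinnertonDyer.Theorems.CyclotomicUntwistFiniteSlopeSeparatedPinnedLogNormOneSidedSigmaLine
  Summit.BirchSwinnertonDyer.BirchSwinnertonDyer.Theorems.PSLineCoefficients
  IsCyclotomicExtension Literature.NumberTheory.EllipticCurves.DescendedFrobenius

namespace Summit.BirchSwinnertonDyer.BirchSwinnertonDyer.Cruxes.PSRankOneLowerHalfAtThree.DFrob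

/-- stub S1p (v9, PRINT PACKET behind C1, FOUR named print facts BY NAME): modularity
(`nonempty_modularParametrizationData`), Gross–Zagier I.(7.3) (`GrossZagier1986_thm_I_7_3`), Deligne's `ℓ`-adic
representations of `Γ₁`-newforms (`Hida2000_thm326_exists_galoisRep`), Carayol 1986 Thm. (A) in Euler-factor form
(`Carayol1986_eulerFactor`). (v7/v8 carried a fifth conjunct, Carayol's level theorem `IsNewformOf.level_eq_conductorNorm`;
it is a tree THEOREM granted modularity — `PSC1OfPrintFive.level_eq_conductorNorm_of_modularity`, p653768 — and is dropped.) PRINT. -/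
theorem stub_PRINT_C1 :
    nonempty_modularParametrizationData ∧
      GrossZagier1986_thm_I_7_3 ∧ Hida2000_thm326_exists_galoisRep ∧ Carayol1986_eulerFactor := by
  sorry

/-- stub S6 = PUB: Gross–Zagier–Kolyvagin (route support item 19921 `PublishedInputGZK`, by name). -/
theorem stub_PUB : PublishedInputGZK := by
  sorry

/-- S1 = EX′ = crux child C1 `PSUntwistedLFunctionAtThree` VERBATIM (v9: NO LONGER A STUB — a THEOREM of this file over the
registered stubs `stub_PRINT_C1` (four named print facts) and `stub_PUB` (GZK), through the landed by-name capstone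
`PSC1OfPrintFive.psUntwistedLFunctionAtThree_of_print5` (cycu-p3 g11, p653768) over `PSC1OfPrint.psUntwistedLFunctionAtThree_of_print`
(lead g8, p651954); v7's `stub_WILD` is discharged inside it by cycu-p3 g10's `InertiaWildAtThree`). -/
theorem stub_EX :
    ∀ (W : WeierstrassCurve ℚ) [W.IsElliptic] [W.IsGloballyMinimal], ¬ W.HasCM →
      Summit.BirchSwinnertonDyer.Rank1Residual.Additive.ClassO6 W 3 → Surj W 3 →
      Even (padicValInt 3 W.minimalDiscriminantInt) →
      W.minimalDiscriminantInt / 3 ^ padicValInt 3 W.minimalDiscriminantInt % 3 = 1 →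
      W.analyticRank = 1 →
      (∃ (η : DirichletCharacter ℂ_[3] (3 ^ 2)) (α : ℂ_[3]) (𝓛 : (n : ℕ) → ZMod (3 ^ n) → ℂ_[3]) (ϖ : ℚ),
          η.IsPrimitive ∧ α ^ 2 - ((W.psUntwistedTrace : ℤ) : ℂ_[3]) * α + 3 = 0 ∧
          IsPSCyclotomicLFunctionOf W η α 𝓛 ∧
          (∀ {N : ℕ} [NeZero N] (f : CuspForm (Gamma0 N) 2), IsNewformOf W f →
            (ϖ : ℝ) * W.realPeriodRat = plusPeriod f)) ∧
        ∃ q : ℚ, W.leadingLCoeff = (((q : ℝ) * W.realPeriodRat * W.regulator : ℝ) : ℂ) := by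
  -- v9: DERIVED from the four-fact print packet and GZK through the landed BY-NAME capstone
  -- `PSC1OfPrintFive.psUntwistedLFunctionAtThree_of_print5` (cycu-p3 g11, p653768) = Carayol's level theorem from modularity ∘
  -- `PSC1OfPrint.psUntwistedLFunctionAtThree_of_print` (lead g8, p651954) = cycu-p4 g12's C1-glue ∘ the lead's uniform
  -- root law `UniformRootLaw.uniformRootLaw_of_print` (p650112) ∘ cycu-p3 g10's wildness `InertiaWildAtThree` (p650778).
  have h : PSUntwistedLFunctionAtThree :=
    Summit.BirchSwinnertonDyer.BirchSwinnertonDyer.Theorems.PSC1OfPrintFive.psUntwistedLFunctionAtThree_of_print5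
      stub_PRINT_C1.1 stub_PRINT_C1.2.1 stub_PUB stub_PRINT_C1.2.2.1 stub_PRINT_C1.2.2.2
  exact h

/-! stub S2k (`stub_KATZ_rankLeTwo_supersingular`: Katz's rank theorem on supersingular fibres — any three second-kind series over a
Weierstrass equation `E/𝓞_{ℚ₃(ζ₉)}` with elliptic special fibre of trace divisible by `3` are `ℚ₃(ζ₉)`-dependent modulo bounded
denominators) is CLOSED (v5): landed VERBATIM by cycu-p4 g8 as `Theorems/CyclotomicUntwistPSRankOneLowerHalfAtThreeKatzRankLeTwoSupersingular.lean`
(p640759), imported above and used by name below. -/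

/-- stub S2e (CLOSED v4 by cycu-p5 g10 `NineRankTwoReduction.secondKind_classEta`, p637942) = THE SECOND NÉRON CLASS IS OF THE SECOND KIND (kernel: the formal `ζ`-addition law
`formalEtaIntegral_coboundary_eq` (p635643) + integrality Part III): on a good model over `𝓞` with supersingular special
fibre, `d(classEta)` and the coboundary of `classEta` under the chord–tangent law have bounded denominators. -/
theorem stub_ETA_secondKind :
    ∀ (W : WeierstrassCurve ℚ) (𝓜 : W.NineGoodModel) (ρ : ONine →+* ZMod 3), (3 : ℤ) ∣ 𝓜.specialFibreTrace ρ →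
      (∃ d : ℕ, ∀ n : ℕ, _root_.IsIntegral ℤ_[3] ((3 : KNine) ^ d * ((n : KNine) * PowerSeries.coeff n 𝓜.classEta))) ∧
      (∃ d' : ℕ, ∀ e : Fin 2 →₀ ℕ, _root_.IsIntegral ℤ_[3] ((3 : KNine) ^ d' * MvPowerSeries.coeff e
        (𝓜.classEta.subst (𝓜.E.map (algebraMap ONine KNine)).formalGroupLaw -
          𝓜.classEta.subst (MvPowerSeries.X 0) - 𝓜.classEta.subst (MvPowerSeries.X 1)))) :=
  fun _ 𝓜 _ _ => Summit.BirchSwinnertonDyer.BirchSwinnertonDyer.Theorems.NineRankTwoReduction.secondKind_classEta 𝓜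

/-- stub S2p (CLOSED v4 by cycu-p5 g10 `NineRankTwoReduction.not_hbd_classEta_sub_C_mul_classOmega` over the unconditional `classesIndependent_of_three_dvd_specialFibreTrace`, p637357/p637942) = THE SECOND NÉRON CLASS IS OFF THE `ω`-LINE (kernel: peel `HBD(L_η + c·log)` along
`[3]` to an exact `𝓞`-integral relation, then `[z³]`: Hasse invariant ⟹ `Δ̄ = 0`, contradiction; or print: Katz 5.7.2):
on a good model over `𝓞` with supersingular special fibre, `classEta − c·classOmega` has unbounded denominators for
every `c ∈ ℚ₃(ζ₉)`. -/
theorem stub_ETA_offOmegaLine :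
    ∀ (W : WeierstrassCurve ℚ) (𝓜 : W.NineGoodModel) (ρ : ONine →+* ZMod 3), (3 : ℤ) ∣ 𝓜.specialFibreTrace ρ →
      ∀ c : KNine, ¬ HasBoundedDenominators (𝓜.classEta - PowerSeries.C c * 𝓜.classOmega) :=
  fun _ 𝓜 ρ hss c => Summit.BirchSwinnertonDyer.BirchSwinnertonDyer.Theorems.NineRankTwoReduction.not_hbd_classEta_sub_C_mul_classOmega 𝓜 ρ hss c

/-- S2a = PRINT input `isDescendedFrobeniusMatrix_exists` — NO LONGER A STUB (v3): derived from S2k, S2e, S2p by the landed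
capstone `NineNamedFactOfKatzRank.isDescendedFrobeniusMatrix_exists_of_katzRankLeTwo_supersingular` (cycu-p1 g6, p637057 /
p637456) with the `η`-inputs discharged by cycu-p5 g10 (`NineRankTwoReduction.isDescendedFrobeniusMatrix_exists_of_katzRank_supersingular`, p637942). Sorry-free modulo S2k. -/
theorem descendedFrobenius_exists_of_stubs : isDescendedFrobeniusMatrix_exists :=
  Summit.BirchSwinnertonDyer.BirchSwinnertonDyer.Theorems.NineRankTwoReduction.isDescendedFrobeniusMatrix_exists_of_katzRank_supersingular
    stub_KATZ_rankLeTwo_supersingular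

/-! stub S2 (`stub_descendedFrobenius`: GIVEN the existence fact, THE descended Frobenius matrix on the principal-series rows
with `tr M = a_w(W)` and `M₁₀ ≠ 0`) is CLOSED: landed VERBATIM (same namespace, same name, registered signature) by cycu-p3 g7 as
`Theorems/CyclotomicUntwistPSRankOneLowerHalfAtThreeDescendedFrobenius.lean` (p629220), imported above and used by name below. -/

/-! stub S3 (`stub_eigenconstant_coeffs`: the eigenline constant lies in `ℚ₃ ⊕ ℚ₃·ζ₃` with non-zero
`ζ₃`-coordinate) is CLOSED: the landed theorem
`Summit.BirchSwinnertonDyer.BirchSwinnertonDyer.Theorems.PSDescendedFrobeniusEigenconstantCoeffs.eigenconstant_coeffs`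
(`Theorems/CyclotomicUntwistDescendedFrobeniusEigenconstantCoeffs.lean`, cycu-p1 g5, p625113, the registered signature
verbatim, 0 sorry) is imported above and used by name in the composition below. -/

/-- stub S4 = N-GZ₃′ AT THE DESCENDED-FROBENIUS EIGENLINE (RESEARCH crux, size XL: the 3-adic Gross–Zagier
formula at slope 1/2 with nebentypus at 3, normed, for the height of the `ψ`-eigenline of `φ_W`): the text of
record N-GZ₃′ `‖c₁(𝓛)·ϖ‖·‖log₃γ‖ = ‖9η(−1)/α²‖·‖q‖₃·‖ι h_ψ(P,P)‖`, re-quantified `∀ M, IsDescendedFrobeniusMatrix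
W M →` `∀ a b` subject to the eigenline dictionary `(a + b·ψ(2))·M₁₀ = M₀₀ + α − tr M`, `∀ Dh` = the σ-line
height with numbers `(c₀, a, b) = (0, a, b)` on the lines `ψ, ψ̄` (deep admissible locus). Coefficient data:
`K = ℚ₃(ζ₃)`, `ψ(2) = ζ₃`, `ι : K ↪ ℂ₃`. -/
theorem stub_NGZ3_dfrob :
    ∀ (ψ : DirichletCharacter (CyclotomicField 3 ℚ_[3]) 9)
      (ι : CyclotomicField 3 ℚ_[3] →ₐ[ℚ_[3]] ℂ_[3]),
      ψ (2 : ZMod 9) = zeta 3 ℚ_[3] (CyclotomicField 3 ℚ_[3]) → Function.Injective ι →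
    ∀ (W : WeierstrassCurve ℚ) [W.IsElliptic] [W.IsGloballyMinimal], ¬ W.HasCM →
      Summit.BirchSwinnertonDyer.Rank1Residual.Additive.ClassO6 W 3 → Surj W 3 →
      Even (padicValInt 3 W.minimalDiscriminantInt) →
      W.minimalDiscriminantInt / 3 ^ padicValInt 3 W.minimalDiscriminantInt % 3 = 1 →
      W.analyticRank = 1 →
      ∀ (η : DirichletCharacter ℂ_[3] (3 ^ 2)) (α : ℂ_[3]) (𝓛 : (n : ℕ) → ZMod (3 ^ n) → ℂ_[3]) (ϖ : ℚ),
        η.IsPrimitive → α ^ 2 - ((W.psUntwistedTrace : ℤ) : ℂ_[3]) * α + 3 = 0 →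
        IsPSCyclotomicLFunctionOf W η α 𝓛 →
        (∀ {N : ℕ} [NeZero N] (f : CuspForm (Gamma0 N) 2), IsNewformOf W f →
          (ϖ : ℝ) * W.realPeriodRat = plusPeriod f) →
      ∀ (M : Matrix (Fin 2) (Fin 2) ℚ_[3]), W.IsDescendedFrobeniusMatrix M →
      ∀ (a b : ℚ_[3]), b ≠ 0 →
        (algebraMap ℚ_[3] ℂ_[3] a + algebraMap ℚ_[3] ℂ_[3] b * ι (ψ 2)) * algebraMap ℚ_[3] ℂ_[3] (M 1 0) =
          algebraMap ℚ_[3] ℂ_[3] (M 0 0) + (α - algebraMap ℚ_[3] ℂ_[3] M.trace) →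
      ∀ Dh : W.PSLineHeightData (CyclotomicField 3 ℚ_[3]),
        (∀ χ : DirichletCharacter (CyclotomicField 3 ℚ_[3]) 9, (χ = ψ ∨ χ = ψ⁻¹) →
          ∀ {x y : ℚ} (hxy : W.toAffine.Nonsingular x y),
            1 < ‖(x : ℚ_[3])‖ → ‖(-(x : ℚ_[3]) / (y : ℚ_[3]))‖ ≤ ((3 : ℝ)⁻¹) ^ 3 →
              (∀ ℓ : ℕ, ℓ.Prime → W.HasNonsingularReductionAt ℓ x y) →
                Dh.pairing χ (.some x y hxy) (.some x y hxy) =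
                  algebraMap ℚ_[3] (CyclotomicField 3 ℚ_[3]) (CensusX42.sigmaHeight W 3
                      ((W.baseChange ℚ_[3]).formalSigma 0) (.some x y hxy)) +
                    (algebraMap ℚ_[3] (CyclotomicField 3 ℚ_[3]) a +
                        algebraMap ℚ_[3] (CyclotomicField 3 ℚ_[3]) b * χ 2) *
                      algebraMap ℚ_[3] (CyclotomicField 3 ℚ_[3])
                        (padicEval (W.baseChange ℚ_[3]).formalLog (-(x : ℚ_[3]) / (y : ℚ_[3]))) ^ 2) →
      ∀ P : W.toAffine.Point, canonicalHeight P = W.regulator →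
      ∀ q : ℚ, W.leadingLCoeff = (((q : ℝ) * W.realPeriodRat * W.regulator : ℝ) : ℂ) →
        ‖gammaMahlerCoeff 3 𝓛 1 * (ϖ : ℂ_[3])‖ *
            ‖algebraMap ℚ_[3] ℂ_[3] (padicLog 3 ((cyclotomicGenerator 3 : ℕ) : ℚ_[3]))‖ =
          ‖(9 * η (-1) / α ^ 2 : ℂ_[3])‖ * ‖(q : ℂ_[3])‖ * ‖ι (Dh.pairing ψ P P)‖ := by
  sorry

/-- stub S5≤ = pBSD₃′^{≤} AT THE DESCENDED-FROBENIUS EIGENLINE, KATO DIRECTION (RESEARCH crux, size L–XL: the one-sided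
`3`-adic BSD leading-term inequality, normed, on the `ψ`-eigenline height): `‖c₁(𝓛)·ϖ‖·‖log₃γ‖ ≤
‖9η(−1)/α²‖·‖#Ш·∏c_ℓ/#tors²‖₃·‖ι h_ψ(P,P)‖`, same re-quantification as S4, v6: UNDER `Finite W.sha` (so that `#Ш = W.shaOrder` is the
true order and `ord₃ #Ш = ord₃ #Ш[3^∞]`; the v5/item-27592 text without this binder silently demanded finiteness of all of `Ш(E)`). -/
theorem stub_pBSD3le_dfrob :
    ∀ (ψ : DirichletCharacter (CyclotomicField 3 ℚ_[3]) 9)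
      (ι : CyclotomicField 3 ℚ_[3] →ₐ[ℚ_[3]] ℂ_[3]),
      ψ (2 : ZMod 9) = zeta 3 ℚ_[3] (CyclotomicField 3 ℚ_[3]) → Function.Injective ι →
    ∀ (W : WeierstrassCurve ℚ) [W.IsElliptic] [W.IsGloballyMinimal], ¬ W.HasCM →
      Summit.BirchSwinnertonDyer.Rank1Residual.Additive.ClassO6 W 3 → Surj W 3 →
      Even (padicValInt 3 W.minimalDiscriminantInt) →
      W.minimalDiscriminantInt / 3 ^ padicValInt 3 W.minimalDiscriminantInt % 3 = 1 →
      W.analyticRank = 1 → Finite W.sha →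
      ∀ (η : DirichletCharacter ℂ_[3] (3 ^ 2)) (α : ℂ_[3]) (𝓛 : (n : ℕ) → ZMod (3 ^ n) → ℂ_[3]) (ϖ : ℚ),
        η.IsPrimitive → α ^ 2 - ((W.psUntwistedTrace : ℤ) : ℂ_[3]) * α + 3 = 0 →
        IsPSCyclotomicLFunctionOf W η α 𝓛 →
        (∀ {N : ℕ} [NeZero N] (f : CuspForm (Gamma0 N) 2), IsNewformOf W f →
          (ϖ : ℝ) * W.realPeriodRat = plusPeriod f) →
      ∀ (M : Matrix (Fin 2) (Fin 2) ℚ_[3]), W.IsDescendedFrobeniusMatrix M →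
      ∀ (a b : ℚ_[3]), b ≠ 0 →
        (algebraMap ℚ_[3] ℂ_[3] a + algebraMap ℚ_[3] ℂ_[3] b * ι (ψ 2)) * algebraMap ℚ_[3] ℂ_[3] (M 1 0) =
          algebraMap ℚ_[3] ℂ_[3] (M 0 0) + (α - algebraMap ℚ_[3] ℂ_[3] M.trace) →
      ∀ Dh : W.PSLineHeightData (CyclotomicField 3 ℚ_[3]),
        (∀ χ : DirichletCharacter (CyclotomicField 3 ℚ_[3]) 9, (χ = ψ ∨ χ = ψ⁻¹) →
          ∀ {x y : ℚ} (hxy : W.toAffine.Nonsingular x y),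
            1 < ‖(x : ℚ_[3])‖ → ‖(-(x : ℚ_[3]) / (y : ℚ_[3]))‖ ≤ ((3 : ℝ)⁻¹) ^ 3 →
              (∀ ℓ : ℕ, ℓ.Prime → W.HasNonsingularReductionAt ℓ x y) →
                Dh.pairing χ (.some x y hxy) (.some x y hxy) =
                  algebraMap ℚ_[3] (CyclotomicField 3 ℚ_[3]) (CensusX42.sigmaHeight W 3
                      ((W.baseChange ℚ_[3]).formalSigma 0) (.some x y hxy)) +
                    (algebraMap ℚ_[3] (CyclotomicField 3 ℚ_[3]) a +
                        algebraMap ℚ_[3] (CyclotomicField 3 ℚ_[3]) b * χ 2) *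
                      algebraMap ℚ_[3] (CyclotomicField 3 ℚ_[3])
                        (padicEval (W.baseChange ℚ_[3]).formalLog (-(x : ℚ_[3]) / (y : ℚ_[3]))) ^ 2) →
      ∀ P : W.toAffine.Point, canonicalHeight P = W.regulator →
        ‖gammaMahlerCoeff 3 𝓛 1 * (ϖ : ℂ_[3])‖ *
            ‖algebraMap ℚ_[3] ℂ_[3] (padicLog 3 ((cyclotomicGenerator 3 : ℕ) : ℚ_[3]))‖ ≤
        ‖(9 * η (-1) / α ^ 2 : ℂ_[3])‖ *
          ‖(((W.shaOrder : ℚ) * (W.tamagawaProduct : ℚ) / (W.torsionOrder : ℚ) ^ 2 : ℚ) : ℂ_[3])‖ *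
          ‖ι (Dh.pairing ψ P P)‖ := by
  sorry

/-! ### Composition (sorry-free) -/

/-- `((a_w : ℤ) : ℂ₃) = algebraMap ℚ₃ ℂ₃ ((a_w : ℤ) : ℚ₃)` (cast bookkeeping). -/
theorem intCast_eq_algebraMap (n : ℤ) : ((n : ℤ) : ℂ_[3]) = algebraMap ℚ_[3] ℂ_[3] (n : ℚ_[3]) := by
  rw [map_intCast]

/-- COMPOSITION CORE (line `dfrob`, lead bsd-line-cycu-p1 g5): **K1 ∧ K2** from the registered stubs (S3 landed,
p625113) — the closer of record `psRankOne_halves_of_separated_pin_intrinsic_sigmaLine_log_norm` over the coefficient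
package `(ℚ₃(ζ₃), ψ, σ, ι)` with `aw := psUntwistedTrace`, `c₀ := 0` and the D5 numbers `(a, b)` CHOSEN (per `(W, α)`) as
the `(1, ζ₃)`-coordinates of the eigenline constant of THE descended Frobenius matrix (`stub_descendedFrobenius` under the
print stub, `eigenconstant_coeffs`; canonical by `IsDescendedFrobeniusMatrix.unique`), so that the `∀ M ∀ a b`-quantified
research stubs S4/S5 apply. Sorry-free. -/
theorem PSRankOneUpperHalfAtThree_of : PSRankOneUpperHalfAtThree := by
  -- the coefficient package
  obtain ⟨ψ, σ, hψ2, hψ3, hψ1, hσ⟩ := exists_line_and_conjugation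
  obtain ⟨ι, hι⟩ := exists_algHom_padicComplex_injective
  -- the eigenline dictionary as a predicate on pairs `(a, b)`
  let Good : (W : WeierstrassCurve ℚ) → ℂ_[3] → ℚ_[3] × ℚ_[3] → Prop := fun W α ab =>
    ab.2 ≠ 0 ∧ ∀ M : Matrix (Fin 2) (Fin 2) ℚ_[3], W.IsDescendedFrobeniusMatrix M →
      (algebraMap ℚ_[3] ℂ_[3] ab.1 + algebraMap ℚ_[3] ℂ_[3] ab.2 * ι (ψ 2)) * algebraMap ℚ_[3] ℂ_[3] (M 1 0) =
        algebraMap ℚ_[3] ℂ_[3] (M 0 0) + (α - algebraMap ℚ_[3] ℂ_[3] M.trace)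
  -- the D5 numbers by choice (junk `(0, 1)` off the locus where the dictionary applies)
  let ab : (W : WeierstrassCurve ℚ) → DirichletCharacter ℂ_[3] (3 ^ 2) → ℂ_[3] → ℚ_[3] × ℚ_[3] :=
    fun W _ α => if h : ∃ p : ℚ_[3] × ℚ_[3], Good W α p then h.choose else (0, 1)
  have hb : ∀ W η α, (ab W η α).2 ≠ 0 := by
    intro W η α
    show (if h : ∃ p : ℚ_[3] × ℚ_[3], Good W α p then h.choose else ((0 : ℚ_[3]), (1 : ℚ_[3]))).2 ≠ 0
    split_ifs with h
    · exact h.choose_spec.1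
    · exact one_ne_zero
  have hgood : ∀ W η α, (∃ p : ℚ_[3] × ℚ_[3], Good W α p) → Good W α (ab W η α) := by
    intro W η α h
    show Good W α (if h : ∃ p : ℚ_[3] × ℚ_[3], Good W α p then h.choose else ((0 : ℚ_[3]), (1 : ℚ_[3])))
    rw [dif_pos h]
    exact h.choose_spec
  -- on a principal-series row the dictionary applies at the admissible root `α`
  have hrow : ∀ (W : WeierstrassCurve ℚ) [W.IsElliptic] [W.IsGloballyMinimal],
      Summit.BirchSwinnertonDyer.Rank1Residual.Additive.ClassO6 W 3 →
      Even (padicValInt 3 W.minimalDiscriminantInt) →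
      W.minimalDiscriminantInt / 3 ^ padicValInt 3 W.minimalDiscriminantInt % 3 = 1 →
      ∀ (η : DirichletCharacter ℂ_[3] (3 ^ 2)) (α : ℂ_[3]),
        α ^ 2 - ((W.psUntwistedTrace : ℤ) : ℂ_[3]) * α + 3 = 0 →
        ∃ M : Matrix (Fin 2) (Fin 2) ℚ_[3], W.IsDescendedFrobeniusMatrix M ∧ Good W α (ab W η α) := by
    intro W _ _ hO6 hev hsq η α hroot
    obtain ⟨M, hM, htr, hγ⟩ := stub_descendedFrobenius descendedFrobenius_exists_of_stubs W hO6 hev hsq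
    have htr' : M.trace = 0 ∨ M.trace = 3 ∨ M.trace = -3 := by
      rcases Summit.BirchSwinnertonDyer.BirchSwinnertonDyer.Theorems.PSUntwistedTrace.psUntwistedTrace_eq_or W
        with h | h | h
      · exact Or.inl (by rw [htr, h]; push_cast; rfl)
      · exact Or.inr (Or.inl (by rw [htr, h]; push_cast; rfl))
      · exact Or.inr (Or.inr (by rw [htr, h]; push_cast; rfl))
    have hroot' : α ^ 2 - algebraMap ℚ_[3] ℂ_[3] M.trace * α + 3 = 0 := by
      rw [htr, ← intCast_eq_algebraMap]; exact hroot
    obtain ⟨a, b, hb0, hdict⟩ :=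
      Summit.BirchSwinnertonDyer.BirchSwinnertonDyer.Theorems.PSDescendedFrobeniusEigenconstantCoeffs.eigenconstant_coeffs
        ψ ι hψ2 hι M α hM.det_eq htr' hγ hroot'
    refine ⟨M, hM, hgood W η α ⟨(a, b), hb0, fun M' hM' => ?_⟩⟩
    rw [hM'.unique hM]
    exact hdict
  -- the closer of record
  have H := psRankOneUpperHalfAtThree_of_separated_pin_intrinsic_sigmaLine_log_norm_le (R := CyclotomicField 3 ℚ_[3])
    ι hι ψ σ hσ ⟨hψ3, hψ1⟩ (fun _ _ _ => (0 : ℚ_[3])) (fun W η α => (ab W η α).1) (fun W η α => (ab W η α).2)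
    (fun _ _ _ => by rw [norm_zero]; exact zero_le_one) hb
    (fun W η α Dh => ∀ χ : DirichletCharacter (CyclotomicField 3 ℚ_[3]) 9, (χ = ψ ∨ χ = ψ⁻¹) →
      ∀ {x y : ℚ} (hxy : W.toAffine.Nonsingular x y),
        1 < ‖(x : ℚ_[3])‖ → ‖(-(x : ℚ_[3]) / (y : ℚ_[3]))‖ ≤ ((3 : ℝ)⁻¹) ^ 3 →
          (∀ ℓ : ℕ, ℓ.Prime → W.HasNonsingularReductionAt ℓ x y) →
            Dh.pairing χ (.some x y hxy) (.some x y hxy) =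
              algebraMap ℚ_[3] (CyclotomicField 3 ℚ_[3]) (CensusX42.sigmaHeight W 3
                  ((W.baseChange ℚ_[3]).formalSigma 0) (.some x y hxy)) +
                (algebraMap ℚ_[3] (CyclotomicField 3 ℚ_[3]) (ab W η α).1 +
                    algebraMap ℚ_[3] (CyclotomicField 3 ℚ_[3]) (ab W η α).2 * χ 2) *
                  algebraMap ℚ_[3] (CyclotomicField 3 ℚ_[3])
                    (padicEval (W.baseChange ℚ_[3]).formalLog (-(x : ℚ_[3]) / (y : ℚ_[3]))) ^ 2)
    (fun W _ _ η α Dh => by simp only [_root_.map_zero, sub_zero])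
    (fun W => W.psUntwistedTrace) stub_PUB stub_EX ?_ ?_
  · exact H
  · -- N-GZ₃′ from S4 at THE matrix and the chosen numbers
    intro W _ _ hCM hO6 hsurj hev hsq hr η α 𝓛 ϖ hη hroot hμ hϖ Dh hDh P hP q hL
    obtain ⟨M, hM, hb0, hdict⟩ := hrow W hO6 hev hsq η α hroot
    exact stub_NGZ3_dfrob ψ ι hψ2 hι W hCM hO6 hsurj hev hsq hr η α 𝓛 ϖ hη hroot hμ hϖ M hM
      (ab W η α).1 (ab W η α).2 hb0 (hdict M hM) Dh hDh P hP q hL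
  · -- pBSD₃′ from S5
    intro W _ _ hCM hO6 hsurj hev hsq hr η α 𝓛 ϖ hη hroot hμ hϖ Dh hDh P hP
    obtain ⟨M, hM, hb0, hdict⟩ := hrow W hO6 hev hsq η α hroot
    -- v6: the finiteness binder of S5≤ is discharged by S6 (GZK at `r_an ≤ 1`)
    have hfin : Finite W.sha := (stub_PUB W hr.le).2
    exact stub_pBSD3le_dfrob ψ ι hψ2 hι W hCM hO6 hsurj hev hsq hr hfin η α 𝓛 ϖ hη hroot hμ hϖ M hM
      (ab W η α).1 (ab W η α).2 hb0 (hdict M hM) Dh hDh P hP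

end Summit.BirchSwinnertonDyer.BirchSwinnertonDyer.Cruxes.PSRankOneLowerHalfAtThree.DFrob
end
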